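import Summits.NavierStokesRegularity.FluidComputer.TubeTablePost18
import HarnessLib

/-!
# Kernel run of the post-ramp box tube, chunks 12 … 17 (bp3 gen 16)

HONEST FRAMING: low prior, high value-of-information experiment on Tao's machine paradigm; NOT a
claim that NS blows up.

Kernel evaluations (`decide +kernel`; no `native_decide`, no extra axioms) of the in-tree tube checker
`runTube` (`P = 60`, 12 Taylor terms, cube `Rt`, read-out `CLt`) on the chunks `cP 12 … cP 17`
(= design chunks `cT 30 … cT 35`) of `TubeTablePost18.lean`, each from the recorded boundary
state `sP i` to `sP (i+1)`.

[cite: Tao2016AveragedNS, §5.5 Thm 5.3 (5.5)]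
-/

namespace Summit.NavierStokesRegularity.FluidComputer

namespace TubeTablePost18

open Literature.Analysis.FluidPDE.FluidComputer Literature.Analysis.FluidPDE.FluidComputer.TubeTable
open Literature.Analysis.FluidPDE.FluidComputer.ThresholdLevelTable (GIt)

set_option maxHeartbeats 10000000 in
set_option maxRecDepth 200000 in
/-- Chunk 12 of the post-ramp tube run (design chunk 30: 50 steps at `h = 2^-11`). [folklore] -/
theorem runP_12 : runTube 60 12 GIt CLt Rt (sP 12) (cP 12) = some (sP (12 + 1)) := by
  decide +kernel

set_option maxHeartbeats 10000000 in
set_option maxRecDepth 200000 in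
/-- Chunk 13 of the post-ramp tube run (design chunk 31: 50 steps at `h = 2^-11`). [folklore] -/
theorem runP_13 : runTube 60 12 GIt CLt Rt (sP 13) (cP 13) = some (sP (13 + 1)) := by
  decide +kernel

set_option maxHeartbeats 10000000 in
set_option maxRecDepth 200000 in
/-- Chunk 14 of the post-ramp tube run (design chunk 32: 50 steps at `h = 2^-11`). [folklore] -/
theorem runP_14 : runTube 60 12 GIt CLt Rt (sP 14) (cP 14) = some (sP (14 + 1)) := by
  decide +kernel

set_option maxHeartbeats 10000000 in
set_option maxRecDepth 200000 in
/-- Chunk 15 of the post-ramp tube run (design chunk 33: 50 steps at `h = 2^-11`). [folklore] -/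
theorem runP_15 : runTube 60 12 GIt CLt Rt (sP 15) (cP 15) = some (sP (15 + 1)) := by
  decide +kernel

set_option maxHeartbeats 10000000 in
set_option maxRecDepth 200000 in
/-- Chunk 16 of the post-ramp tube run (design chunk 34: 50 steps at `h = 2^-11`). [folklore] -/
theorem runP_16 : runTube 60 12 GIt CLt Rt (sP 16) (cP 16) = some (sP (16 + 1)) := by
  decide +kernel

set_option maxHeartbeats 10000000 in
set_option maxRecDepth 200000 in
/-- Chunk 17 of the post-ramp tube run (design chunk 35: 50 steps at `h = 2^-11`). [folklore] -/
theorem runP_17 : runTube 60 12 GIt CLt Rt (sP 17) (cP 17) = some (sP (17 + 1)) := by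
  decide +kernel

end TubeTablePost18

end Summit.NavierStokesRegularity.FluidComputer
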